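import Summits.ABC.IUTFork.Repair.RHHeightScaling
import Mathlib.Data.Nat.Log
import HarnessLib

/-!
# R-H ROUND 4, row R4-6 (i) «R4OBJ-DEG» — BASE-FIELD-DEGREE / TOWER SCALING of the typed cell: degree homogeneity of demand and price cap,
# licence persistence under a ramified base change, and the integer bracket of the log-shell OUTER radius `R_out = −e·⌊log_p e⌋ + O(e)` —
# the one cell quantity that is not degree-homogeneous (abc-iut-rh2-q2-hull gen 17, KEY `wake/KEY-abc-iut-rh2-q2-hull-R4OBJ-DEG.md`)

abc-iut cell, rung LADDER-ABC:A2.RESCUE.H; ROUND-4 OPENINGS CENSUS row O-06 (rh-lead g5), R4-TASKS.md row 7. Source re-read first-hand: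
Mochizuki–Fesenko–Hoshi–Minamide–Porowski, «Explicit estimates in inter-universal Teichmüller theory», Kodai Math. J. 45 (2022) 175–236
(lit store `book:anonnd-eeiutp-1`): every height / arithmetic degree there is NORMALISED by `1/[F:ℚ]` with local weights `[F_v:ℚ_p]` (Def. 1.1,
Rmk. 1.1.1 p. 184; `h = log(q^E) = (1/[F:ℚ])·Σ_v h_v·f_v·log p_v` p. 213; «the various log(q(−))'s are independent of the choice of F_k», Thm. 5.1
p. 209), and the base-field degree enters Thm. 5.1 only through `d_mod = [F_mod:ℚ]` and the maximal ramification index `e_mod` (p. 208) — in the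
multiplier `(1 + 20·d_mod/l)` and the additive `4.0881·e*_mod·l` (p. 209), both COSTS on the requirement side.

DEGREE SCALING IN CELL CURRENCY (this seat's reading, memo `plan/rescue/R-H/ROUND4/R4-6-DEG-rh2-q2-hull.md`): base change of the datum to a base field
of degree `d = ε·φ·g` at the bad prime `p` (ramification `ε`, residue degree `φ`, splitting `g`) acts on the normalised conjugate-fibre cell
`RH.DiffPricedHull.HullCellδ e m j δ r_in r_out` (weights `c_w = ln p/(e_w·l⋆)`, `Σ_{w∣p} n_w/[K:ℚ] = 1`) ONLY through `ε`:
`e ↦ ε·e`, `m ↦ ε·m`, `δ ↦ ε·δ + (ε−1)` (tame relative different), `r_in = ⌊e/(p−1)⌋+1 ↦ ⌊εe/(p−1)⌋+1`, `r_out = min_{a≥0}(p^a − a·e) ↦ min_a(p^a − a·εe)`,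
`c_w ↦ c_w/ε`; `φ`, `g`, `l`, the labels and the places are invisible.

WHAT IS PROVED (namespace `Summit.ABC.IUTFork.Repair.RH.HeightScalingDegree`; PROOF-ONLY over abc-iut-rh2-T-1's `RHHeightScaling` vocabulary and
lens-transfer-3's `HullCellδ`; integers):
* §1 HOMOGENEITY. `demand_degree`: `demand (ε·m) j = ε·demand m j` (the normalised demand `c_w·demand` is degree-INVARIANT). `priceCap_degree`:
  `priceCap (εe) (εδ+(ε−1)) r_in' r_out' j = ε·priceCap e δ r_in r_out j + 2j·[(r_in' − r_out') − ε(r_in − r_out) + (ε−1)]` — the conductor-type cap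
  is homogeneous UP TO THE LOG-SHELL SPAN DEFECT `G' − εG` (and the tame `ε−1`); `price_le_priceCap_degree`: the scaled cell is still inside
  rh2-T-1's price ceiling, so every class certificate over degree-scaled cells is `PriceBounded` ⇒ exponent `−1` ⇒ `¬Door` by `not_door_of_priceBounded`
  VERBATIM — degree scaling moves CONSTANTS, never EXPONENTS.
* §2 LICENCE PERSISTENCE. `hullCellδ_degree`: a licensed cell stays licensed after the tame degree scaling whenever `ε·r_in ≤ r_in' + (ε−1)` and
  `r_out' ≤ ε·r_out` — both discharged for the radii of record (`mul_ediv_succ_le`, `sub_mul_le_mul_sub`): the kept fraction at FIXED height is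
  non-decreasing in the degree (bed: μ₄ FREY133 0.5242 → 1.000 by ε = 2²², engine d2deg / kit j280647).
* §3 THE OUTER-RADIUS BRACKET. For `2 ≤ p`, `1 ≤ e`: every `p^a − a·e ≥ −(⌊log_p e⌋+1)·e` (`neg_log_succ_mul_le_pow_sub_mul`) and
  `p^{⌊log_p e⌋} − ⌊log_p e⌋·e ≤ −(⌊log_p e⌋−1)·e`; hence the attained minimum satisfies `−(⌊log_p e⌋+1)·e ≤ r_out ≤ −(⌊log_p e⌋−1)·e`
  (`rout_bracket`): `−r_out/e = log_p e + O(1)`, so under `e ↦ εe` the span per unit `G/e` grows like `log_p ε` — `(j+1)·ln ε/l⋆` nats of h-FREE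
  credit per cell, the bad-place image of print's `e*_mod·l` ([IUTchIV] Prop. 1.2 denominators of `log_p`; Thm. 5.1 Step (viii)).
* §4 BED ROWS by `decide`: FREY `2⁵67⁸107·22381+5⁴53⁶353⁵ @ l = 107`, `p = 3` (`e = 3210`, `r_out = −20283 = 3⁷ − 7·3210`, bracket `[6,8]·3210`;
  at `ε = 2`: `e = 6420`, `r_out = −44799 = 3⁸ − 8·6420`; slice boundary 43 → 46); HEX `λ₈ @ l = 11`, `p = 7` (rh2-T-1's `row_hex8_l11`: label 5 OFF
  at `ε = 1`, ON at `ε = 2` with `e = 330`, `r_out = −647`).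
HONEST FRAMING: integer identities about OUR typed cell and one transcription of a published paper's normalisation; nothing here asserts that abc
is proved or refuted, or takes a side on [IUTchIII] Cor. 3.12 / [IUTchIV] Thm. 1.10 or on any author; the degree-scaled cell is a claim-tagged
MODELLING of base change (tame relative different; a wild `p ∣ ε` only raises `δ`, `hullCellδ_mono`), not a Literature fact; typed ≠ proved;
computed ≠ proved. [cite: Mochizuki2012, IUTchIV Prop. 1.2 p. 10, Prop. 1.4 p. 13, Thm. 1.10 Step (viii) p. 30] [claim: Mochizuki2012, status: disputed]
-/

namespace Summit.ABC.IUTFork.Repair.RH.HeightScalingDegree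

open Finset
open Summit.ABC.IUTFork.Repair.RH.DiffPricedHull Summit.ABC.IUTFork.Repair.RH.HeightScaling

/-! ## §1. Degree homogeneity of demand and price cap -/

/-- **Demand is degree-homogeneous**: `demand (ε·m) j = ε·demand m j` (so the normalised demand `(ln p/(εe·l⋆))·demand (εm) j` is
degree-invariant). [folklore] -/
theorem demand_degree (ε m j : ℤ) : demand (ε * m) j = ε * demand m j :=
  demand_dilate ε m j

/-- **The price cap is degree-homogeneous up to the log-shell span defect**: with the tame scaled different `εδ + (ε−1)` and ANY scaled radii
`r_in'`, `r_out'`, `priceCap (εe) (εδ+(ε−1)) r_in' r_out' j = ε·priceCap e δ r_in r_out j + 2j·[(r_in' − r_out') − ε·(r_in − r_out) + (ε−1)]`. [folklore] -/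
theorem priceCap_degree (ε e δ rin rout rin' rout' j : ℤ) :
    priceCap (ε * e) (ε * δ + (ε - 1)) rin' rout' j =
      ε * priceCap e δ rin rout j + 2 * j * ((rin' - rout') - ε * (rin - rout) + (ε - 1)) := by
  unfold priceCap; ring

/-- **The degree-scaled cell is still inside the price ceiling** (`0 < e`, `1 ≤ ε`, `r_out' ≤ r_in'`, `j ≥ 1`): rh2-T-1's `price_le_priceCap`
at the scaled integers — so every certificate over degree-scaled cells is `PriceBounded` and `not_door_of_priceBounded` applies verbatim. [folklore] -/
theorem price_le_priceCap_degree {ε e m j δ rin' rout' : ℤ} (he : 0 < e) (hε : 1 ≤ ε) (hio : rout' ≤ rin') (hj : 1 ≤ j) :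
    price (ε * e) m j (ε * δ + (ε - 1)) rin' rout' ≤ priceCap (ε * e) (ε * δ + (ε - 1)) rin' rout' j :=
  price_le_priceCap (mul_pos (by linarith) he) hio hj

/-- An explicit m-FREE bound for the scaled cap from radii bounds `r_in' ≤ B_in`, `−r_out' ≤ B_out` (`j ≥ 0`, `0 ≤ εδ + ε − 1 + … `):
`priceCap (εe) (εδ+(ε−1)) r_in' r_out' j ≤ (εδ + (ε−1) + 2(B_in + B_out) + (εe − 1))·j`. [folklore] -/
theorem priceCap_degree_le {ε e δ rin' rout' Bin Bout j : ℤ} (hj : 0 ≤ j) (hin : rin' ≤ Bin) (hout : -rout' ≤ Bout) :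
    priceCap (ε * e) (ε * δ + (ε - 1)) rin' rout' j ≤ (ε * δ + (ε - 1) + 2 * (Bin + Bout) + (ε * e - 1)) * j := by
  unfold priceCap
  exact mul_le_mul_of_nonneg_right (by linarith) hj

/-! ## §2. Licence persists under the tame degree scaling -/

/-- Floor bookkeeping: `N ≤ ε·X + (ε−1)`, `0 < e`, `1 ≤ ε` ⇒ `N/(εe) ≤ X/e` (`/` = `Int.ediv` = floor for positive divisors). [folklore] -/
theorem ediv_scaled_le {N X e ε : ℤ} (he : 0 < e) (hε : 1 ≤ ε) (hN : N ≤ ε * X + (ε - 1)) : N / (ε * e) ≤ X / e := by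
  have hε0 : 0 < ε := by linarith
  have hεe : 0 < ε * e := mul_pos hε0 he
  have h1 : X < (X / e + 1) * e := Int.lt_ediv_add_one_mul_self X he
  have h2 : N < (X / e + 1) * (ε * e) := by nlinarith
  have h3 : N / (ε * e) < X / e + 1 := (Int.ediv_lt_iff_lt_mul hεe).mpr h2
  linarith

/-- **LICENCE PERSISTENCE.** If the cell `(e, m, j, δ, r_in, r_out)` is licensed (`HullCellδ`), `0 < e`, `1 ≤ ε`, `0 ≤ j`, and the scaled radii
satisfy `ε·r_in ≤ r_in' + (ε−1)` (inner radius per unit does not shrink by more than the rounding) and `r_out' ≤ ε·r_out` (outer radius per unit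
does not shrink), then the tame degree-scaled cell `(εe, εm, j, εδ+(ε−1), r_in', r_out')` is licensed. (The different increment `j(ε−1)` pays
for the inner-radius rounding loss `(j+1)(ε−1)` up to one unit, which the floor absorbs.) [folklore] -/
theorem hullCellδ_degree {ε e m j δ rin rout rin' rout' : ℤ} (he : 0 < e) (hε : 1 ≤ ε) (hj : 0 ≤ j)
    (hrin : ε * rin ≤ rin' + (ε - 1)) (hrout : rout' ≤ ε * rout) (h : HullCellδ e m j δ rin rout) :
    HullCellδ (ε * e) (ε * m) j (ε * δ + (ε - 1)) rin' rout' := by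
  unfold HullCellδ at h ⊢
  have hε0 : 0 ≤ ε := by linarith
  have hεe : 0 < ε * e := mul_pos (by linarith) he
  -- the scaled numerator is at most ε·X + (ε − 1)
  have hN : j ^ 2 * (ε * m) - j * (ε * δ + (ε - 1)) - (j + 1) * rin' ≤
      ε * (j ^ 2 * m - j * δ - (j + 1) * rin) + (ε - 1) := by
    nlinarith [mul_le_mul_of_nonneg_left hrin (show (0 : ℤ) ≤ j + 1 by linarith)]
  have hdiv := ediv_scaled_le (X := j ^ 2 * m - j * δ - (j + 1) * rin) he hε hN
  have h1 : ε * e * ((j ^ 2 * (ε * m) - j * (ε * δ + (ε - 1)) - (j + 1) * rin') / (ε * e)) ≤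
      ε * (e * ((j ^ 2 * m - j * δ - (j + 1) * rin) / e)) := by
    rw [mul_assoc]
    exact mul_le_mul_of_nonneg_left (mul_le_mul_of_nonneg_left hdiv he.le) hε0
  have h2 : ε * (e * ((j ^ 2 * m - j * δ - (j + 1) * rin) / e)) ≤ ε * (m - (j + 1) * rout) :=
    mul_le_mul_of_nonneg_left h hε0
  have h3 : (j + 1) * rout' ≤ (j + 1) * (ε * rout) := mul_le_mul_of_nonneg_left hrout (by linarith)
  nlinarith

/-- Inner radius of record `r_in = ⌊e/(p−1)⌋ + 1`: under `e ↦ εe` the hypothesis of `hullCellδ_degree` holds —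
`ε·(e/n + 1) ≤ (εe)/n + 1 + (ε−1)` for `0 < n`, `0 ≤ ε`. [folklore] -/
theorem mul_ediv_succ_le {ε e n : ℤ} (hn : 0 < n) (hε : 0 ≤ ε) : ε * (e / n + 1) ≤ ε * e / n + 1 + (ε - 1) := by
  have h : ε * (e / n) ≤ ε * e / n := Int.mul_ediv_le_mul_ediv_assoc hε e hn.le
  linarith

/-- Outer radius of record `r_out = min_{a≥0}(p^a − a·e)`: each term only improves under `e ↦ εe` — `p^a − a·(εe) ≤ ε·(p^a − a·e)` for `ε ≥ 1`,
`p^a ≥ 0`; so the scaled minimum is `≤ ε·` the old one (hypothesis `r_out' ≤ ε·r_out` of `hullCellδ_degree`). [folklore] -/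
theorem sub_mul_le_mul_sub {ε P a e : ℤ} (hε : 1 ≤ ε) (hP : 0 ≤ P) : P - a * (ε * e) ≤ ε * (P - a * e) := by
  nlinarith

/-- Assembly of the two radius facts: if `r_out'` is below every scaled term and `r_out` is an attained term, then `r_out' ≤ ε·r_out`. [folklore] -/
theorem rout_scaled_le {ε e rout rout' : ℤ} {p : ℕ} (hε : 1 ≤ ε) (hmin : ∀ a : ℕ, rout' ≤ (p : ℤ) ^ a - a * (ε * e))
    (hatt : ∃ a : ℕ, rout = (p : ℤ) ^ a - a * e) : rout' ≤ ε * rout := by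
  obtain ⟨a, rfl⟩ := hatt
  exact (hmin a).trans (sub_mul_le_mul_sub hε (by positivity))

/-! ## §3. The outer-radius bracket `−(⌊log_p e⌋+1)·e ≤ r_out ≤ −(⌊log_p e⌋−1)·e` -/

/-- Every term of the outer-radius minimum is `≥ −(⌊log_p e⌋+1)·e` (`2 ≤ p`): for `a ≤ ⌊log_p e⌋+1` because `p^a ≥ 0`, beyond because
`p^a ≥ p^{⌊log_p e⌋+1}·p^{a−⌊log_p e⌋−1} > e·(a − ⌊log_p e⌋ − 1)`. [folklore] -/
theorem neg_log_succ_mul_le_pow_sub_mul {p : ℕ} (hp : 2 ≤ p) (e a : ℕ) :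
    -(((Nat.log p e + 1) * e : ℕ) : ℤ) ≤ (p : ℤ) ^ a - (a : ℤ) * e := by
  set A := Nat.log p e + 1 with hA
  rcases le_or_gt a A with h | h
  · have h1 : ((a : ℕ) : ℤ) * e ≤ ((A * e : ℕ) : ℤ) := by
      push_cast; exact mul_le_mul_of_nonneg_right (by exact_mod_cast h) (by positivity)
    have h2 : (0 : ℤ) ≤ (p : ℤ) ^ a := by positivity
    linarith
  · -- a = A + k with k ≥ 1
    obtain ⟨k, rfl⟩ := Nat.exists_eq_add_of_lt h
    have hpA : e < p ^ A := Nat.lt_pow_succ_log_self (by omega) e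
    have hk : A + k + 1 - A = k + 1 := by omega
    have hpk : k + 1 < p ^ (k + 1) := Nat.lt_pow_self (by omega)
    have hpow : (p : ℤ) ^ (A + k + 1) = (p : ℤ) ^ A * (p : ℤ) ^ (k + 1) := by rw [← pow_add]; ring_nf
    have h3 : ((e : ℤ) + 1) * ((k : ℤ) + 1) ≤ (p : ℤ) ^ A * (p : ℤ) ^ (k + 1) := by
      have ha : (e : ℤ) + 1 ≤ (p : ℤ) ^ A := by exact_mod_cast hpA
      have hb : (k : ℤ) + 1 ≤ (p : ℤ) ^ (k + 1) := by exact_mod_cast hpk.le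
      exact mul_le_mul ha hb (by positivity) (by positivity)
    rw [hpow]; push_cast
    nlinarith

/-- At `a = ⌊log_p e⌋` the term is `≤ −(⌊log_p e⌋−1)·e` (`1 ≤ e`, since `p^{⌊log_p e⌋} ≤ e`). [folklore] -/
theorem pow_log_sub_mul_le {p e : ℕ} (he : 1 ≤ e) :
    (p : ℤ) ^ (Nat.log p e) - (Nat.log p e : ℤ) * e ≤ -(((Nat.log p e : ℤ) - 1) * e) := by
  have h : ((p ^ Nat.log p e : ℕ) : ℤ) ≤ e := by exact_mod_cast Nat.pow_log_le_self p (by omega)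
  push_cast at h
  linarith

/-- **THE OUTER-RADIUS BRACKET.** If `r_out` is a lower bound of all the terms `p^a − a·e` and is attained (the tree's `min_{a≥0}(p^a − a·e)`),
`2 ≤ p`, `1 ≤ e`, then `−(⌊log_p e⌋+1)·e ≤ r_out ≤ −(⌊log_p e⌋−1)·e`: the log-shell outer radius is `−e·log_p e + O(e)`, NOT degree-homogeneous —
under `e ↦ εe` the span per unit grows like `log_p ε`. [folklore] -/
theorem rout_bracket {p e : ℕ} {rout : ℤ} (hp : 2 ≤ p) (he : 1 ≤ e) (hmin : ∀ a : ℕ, rout ≤ (p : ℤ) ^ a - (a : ℤ) * e)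
    (hatt : ∃ a : ℕ, rout = (p : ℤ) ^ a - (a : ℤ) * e) :
    -(((Nat.log p e : ℤ) + 1) * e) ≤ rout ∧ rout ≤ -(((Nat.log p e : ℤ) - 1) * e) := by
  refine ⟨?_, (hmin (Nat.log p e)).trans (pow_log_sub_mul_le he)⟩
  obtain ⟨a, rfl⟩ := hatt
  have h := neg_log_succ_mul_le_pow_sub_mul hp e a
  push_cast at h
  linarith

/-- The two trivial upper bounds: `r_out ≤ 1` (`a = 0`) and `r_out ≤ p − e` (`a = 1`) — so the span switches on (`r_out ≤ 0`) exactly when `e ≥ p`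
becomes reachable, i.e. ramifying past `p` is what inflates the log shell. [folklore] -/
theorem rout_le_one_and_le_sub {p e : ℕ} {rout : ℤ} (hmin : ∀ a : ℕ, rout ≤ (p : ℤ) ^ a - (a : ℤ) * e) :
    rout ≤ 1 ∧ rout ≤ (p : ℤ) - e := by
  refine ⟨by simpa using hmin 0, by simpa using hmin 1⟩

/-! ## §4. Bed rows (`decide`) -/

/-- FREY `2⁵67⁸107·22381+5⁴53⁶353⁵ @ l = 107`, place `p = 3` (window-table v4.11: `e = 3210`, `m_q = 660`, `δ = 6419`, `r_in = 1606`, `r_out = −20283`):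
`r_out = 3⁷ − 7·3210`, `⌊log₃ 3210⌋ = 7`, bracket `6·3210 ≤ 20283 ≤ 8·3210`; the terms `a = 0…12` are all `≥ −20283`. Degree 2 (tame model):
`e = 6420`, `δ = 12839`, `r_in = 3211` (hypothesis `2·1606 ≤ 3211 + 1`), `r_out = −44799 = 3⁸ − 8·6420 ≤ 2·(−20283)`, `⌊log₃ 6420⌋ = 7`, bracket
`6·6420 ≤ 44799 ≤ 8·6420`. [folklore] -/
theorem frey_p3_l107_radii :
    (-20283 : ℤ) = 3 ^ 7 - 7 * 3210 ∧ Nat.log 3 3210 = 7 ∧ (6 : ℤ) * 3210 ≤ 20283 ∧ (20283 : ℤ) ≤ 8 * 3210 ∧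
      (∀ a ∈ Finset.range 13, (-20283 : ℤ) ≤ 3 ^ a - (a : ℤ) * 3210) ∧
      (-44799 : ℤ) = 3 ^ 8 - 8 * 6420 ∧ Nat.log 3 6420 = 7 ∧ (6 : ℤ) * 6420 ≤ 44799 ∧ (44799 : ℤ) ≤ 8 * 6420 ∧
      (2 : ℤ) * 1606 ≤ 3211 + (2 - 1) ∧ (-44799 : ℤ) ≤ 2 * (-20283) := by
  refine ⟨by norm_num, ?_, by norm_num, by norm_num, by decide, by norm_num, ?_, by norm_num, by norm_num, by norm_num, by norm_num⟩
  · rw [Nat.log_eq_iff (Or.inl (by norm_num))]; norm_num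
  · rw [Nat.log_eq_iff (Or.inl (by norm_num))]; norm_num

/-- Same place, SLICE BOUNDARY under degree 2: at `ε = 1` labels `≤ 43` are licensed and `44` is not; at `ε = 2` (`e = 6420`, `m = 1320`,
`δ = 12839`, `r_in = 3211`, `r_out = −44799`) labels `44…46` are licensed and `47` is not — the kept slice GROWS with the degree at fixed
height (engine d2deg: `J = 43 → 46`). [folklore] -/
theorem frey_p3_l107_slice_degree_two :
    HullCellδ 3210 660 43 6419 1606 (-20283) ∧ ¬ HullCellδ 3210 660 44 6419 1606 (-20283) ∧
      HullCellδ 6420 1320 44 12839 3211 (-44799) ∧ HullCellδ 6420 1320 46 12839 3211 (-44799) ∧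
      ¬ HullCellδ 6420 1320 47 12839 3211 (-44799) := by
  unfold HullCellδ; decide

/-- HEX `λ₈ @ l = 11`, `p = 7` (rh2-T-1's `row_hex8_l11`: `e = 165`, `m = 120`, `δ = 164`, `r_in = 28`, `r_out = −281 = 7² − 2·165`, `⌊log₇ 165⌋ = 2`,
bracket `165 ≤ 281 ≤ 495`): the top label `5` is OFF; after a degree-2 base change (tame model: `e = 330`, `m = 240`, `δ = 329`, `r_in = 56`,
`r_out = −647 = 7³ − 3·330 ≤ 2·(−281)`) label `5` is ON — every cell of the place licensed by ramification alone. [folklore] -/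
theorem hex8_l11_p7_degree_two :
    (-281 : ℤ) = 7 ^ 2 - 2 * 165 ∧ Nat.log 7 165 = 2 ∧ (-647 : ℤ) = 7 ^ 3 - 3 * 330 ∧ (-647 : ℤ) ≤ 2 * (-281) ∧
      ¬ HullCellδ 165 120 5 164 28 (-281) ∧ HullCellδ 330 240 5 329 56 (-647) ∧ HullCellδ 330 240 4 329 56 (-647) := by
  refine ⟨by norm_num, ?_, by norm_num, by norm_num, ?_⟩
  · rw [Nat.log_eq_iff (Or.inl (by norm_num))]; norm_num
  · unfold HullCellδ; decide

end Summit.ABC.IUTFork.Repair.RH.HeightScalingDegree
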